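import Summits.AtomisticToContinuum.HydrodynamicLimit.Theorems.BoxDissipativeWeakStrongRelativeEnergyStabilityClampChoice
import Literature.Analysis.FluidPDE.MVRelativeEnergyMaster
import Literature.MathematicalPhysics.KineticTheory.HardSphereEulerLocalTheoryProofs
import HarnessLib

/-!
# Crux `RelativeEnergyStability` (stmt-AtomisticToContinuum-17653), line `registered`:
helpers of the stub `stub_cutEosMaster` (S-M) — calculus and global coercivity of the cut hard-sphere law

The cut law `cutEOS σ η₁` (`p = ρϑ Z_cut(ρσ³)`, `s = 3/2 log ϑ − log ρ − F_cut(ρσ³)`) is Gibbs-consistent but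
only `C¹` across the band edge `ρσ³ = η₁` (the pressure has a kink), so BF's coercivity lemmas
(`BallisticFreeEnergyCoercivity.lean`, which need `IsGibbs`/`IsThermodynamicallyStable`) do not apply to it
directly. This file supplies the explicit substitute used by S-M (and by S3'):

* `cm_hasDerivAt_cutF` — under `HsEosLowDensity` (`f_ex = F` analytic on `[0,η₀)`, `η₁ < η₀`),
  `F_cut'(η) = (Z_cut(η) − 1)/η` for every `η > 0` (one-sided derivatives glued at `η₁`);
* `cm_relEnergyThermo_monatomic` — for any monatomic law `R(ρ,ϑ | r,Θ) = 3/2 ρ(ϑ − Θ − Θ log(ϑ/Θ))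
  + Θ·Bregman_φ(ρ | r)`, `φ(ρ) = ρ log ρ + ρ f(ρ)`;
* `cm_psi_monotoneOn`, `cm_bregman_cut_ge` — `φ − z ρ log ρ` is convex for the cut law once
  `z ≤ (ηZ)'` on `(0,η₁)` and `z ≤ Z(η₁)` (true with `z = 1/2` for small `η₁`), whence
* `cm_relEnergyThermo_cut_ge` (registered helper sub-goal) — `R_cut ≥ z · R_ideal` globally on the open
  quadrant, `R_ideal` being the relative thermal energy of the monatomic ideal gas `monatomicExcess 1 0`, to which
  the BF coercivity/growth lemmas DO apply.

References: BrezinaFeireisl2018 §3.2 (3.8); FeireislNovotny2009 Ch. 3 Prop. 3.2; FeireislNovotny2012 §3.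
-/

noncomputable section

namespace Summit.AtomisticToContinuum.HydrodynamicLimit.Theorems.RES

open MeasureTheory Filter Set Metric
open scoped Topology
open Summit.AtomisticToContinuum.HydrodynamicLimit.Theses.BoxDissipativeWeakStrong
open Literature.MathematicalPhysics.KineticTheory Literature.Analysis.FluidPDE
open Literature.Analysis.FluidPDE.CompressibleEuler
open Literature.Analysis.FluidPDE.CompressibleEuler.EulerPhase
open Literature.Analysis.FluidPDE.CompressibleEuler.StrongPointData

/-! ## The cut law on the two sides of the band edge -/

section CutLaw

variable {η₀ η₁ : ℝ} {F : ℝ → ℝ}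

/-- Below the band edge the cut excess free energy is the hard-sphere one: `F_cut(η) = f_ex(η)` for
`η ≤ η₁` (`0 < η₁`). -/
theorem cm_cutF_of_le (hη₁ : 0 < η₁) {η : ℝ} (hle : η ≤ η₁) :
    cutExcessFreeEnergy η₁ η = hsExcessFreeEnergy η := by
  simp only [cutExcessFreeEnergy, min_eq_left hle, max_eq_right hle, div_self hη₁.ne', Real.log_one,
    mul_zero, add_zero]

/-- Above the band edge: `F_cut(η) = f_ex(η₁) + (Z(η₁) − 1) log(η/η₁)` for `η₁ ≤ η`. -/
theorem cm_cutF_of_ge {η : ℝ} (hle : η₁ ≤ η) :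
    cutExcessFreeEnergy η₁ η =
      hsExcessFreeEnergy η₁ + (hsCompressibility η₁ - 1) * Real.log (η / η₁) := by
  simp only [cutExcessFreeEnergy, min_eq_right hle, max_eq_left hle]

/-- Below the band edge `Z_cut(η) = Z(η)`. -/
theorem cm_cutZ_of_le {η : ℝ} (hle : η ≤ η₁) : cutCompressibility η₁ η = hsCompressibility η := by
  simp only [cutCompressibility, min_eq_left hle]

/-- Above the band edge `Z_cut(η) = Z(η₁)`. -/
theorem cm_cutZ_of_ge {η : ℝ} (hle : η₁ ≤ η) : cutCompressibility η₁ η = hsCompressibility η₁ := by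
  simp only [cutCompressibility, min_eq_right hle]

/-- Under the EOS fact, `F_cut = F` on `[0, η₁]` (`η₁ < η₀`). -/
theorem cm_cutF_eq_F (hEq : EqOn hsExcessFreeEnergy F (Ico 0 η₀)) (hη₁ : 0 < η₁) (hη₁₀ : η₁ < η₀) {η : ℝ}
    (h0 : 0 ≤ η) (hle : η ≤ η₁) : cutExcessFreeEnergy η₁ η = F η := by
  rw [cm_cutF_of_le hη₁ hle, hEq ⟨h0, hle.trans_lt hη₁₀⟩]

/-- **`F_cut` is `C¹` across the band edge**: for every `η > 0`,
`F_cut'(η) = (Z_cut(η) − 1)/η` (`= F'(η)` below `η₁`, `= (Z(η₁) − 1)/η` above, both `= F'(η₁)` at `η₁`). -/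
theorem cm_hasDerivAt_cutF (hF : AnalyticOnNhd ℝ F (Ioo (-η₀) η₀))
    (hEq : EqOn hsExcessFreeEnergy F (Ico 0 η₀)) (hη₁ : 0 < η₁) (hη₁₀ : η₁ < η₀) {η : ℝ} (hη : 0 < η) :
    HasDerivAt (cutExcessFreeEnergy η₁) ((cutCompressibility η₁ η - 1) / η) η := by
  have hFd : ∀ x ∈ Ioo (-η₀) η₀, HasDerivAt F (deriv F x) x := fun x hx =>
    (hF x hx).differentiableAt.hasDerivAt
  -- the formula above the edge, as a function
  have hG : ∀ x, 0 < x → HasDerivAt (fun y => hsExcessFreeEnergy η₁ +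
      (hsCompressibility η₁ - 1) * Real.log (y / η₁)) ((hsCompressibility η₁ - 1) / x) x := by
    intro x hx
    have h1 : HasDerivAt (fun y => Real.log (y / η₁)) (x⁻¹) x := by
      have h := ((hasDerivAt_id x).div_const η₁).log (by simp only [id]; positivity : id x / η₁ ≠ 0)
      refine h.congr_deriv ?_
      simp only [id]
      field_simp
    exact ((h1.const_mul (hsCompressibility η₁ - 1)).const_add (hsExcessFreeEnergy η₁)).congr_deriv
      (by rw [div_eq_mul_inv])
  rcases lt_trichotomy η η₁ with hlt | heq | hgt
  · -- below the edge: `F_cut = F` near `η`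
    have hev : cutExcessFreeEnergy η₁ =ᶠ[𝓝 η] F := by
      filter_upwards [Ioo_mem_nhds hη hlt] with x hx
      exact cm_cutF_eq_F hEq hη₁ hη₁₀ hx.1.le hx.2.le
    refine ((hFd η ⟨by linarith, hlt.trans hη₁₀⟩).congr_of_eventuallyEq hev).congr_deriv ?_
    rw [cm_cutZ_of_le hlt.le, hsCompressibility_eq hEq ⟨hη, hlt.trans hη₁₀⟩]
    field_simp
    ring
  · -- at the edge: one-sided derivatives agree
    subst heq
    have hval : (cutCompressibility η η - 1) / η = deriv F η := by
      rw [cm_cutZ_of_le le_rfl, hsCompressibility_eq hEq ⟨hη, hη₁₀⟩]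
      field_simp
      ring
    rw [hval]
    have hleft : HasDerivWithinAt (cutExcessFreeEnergy η) (deriv F η) (Iic η) η := by
      refine (hFd η ⟨by linarith, hη₁₀⟩).hasDerivWithinAt.congr_of_eventuallyEq ?_ ?_
      · have : Ioi (0:ℝ) ∈ 𝓝[Iic η] η := mem_nhdsWithin_of_mem_nhds (Ioi_mem_nhds hη)
        filter_upwards [this, self_mem_nhdsWithin] with x hx0 hxle
        exact cm_cutF_eq_F hEq hη hη₁₀ (le_of_lt hx0) hxle
      · exact cm_cutF_eq_F hEq hη hη₁₀ hη.le le_rfl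
    have hright : HasDerivWithinAt (cutExcessFreeEnergy η) (deriv F η) (Ici η) η := by
      have hval' : (hsCompressibility η - 1) / η = deriv F η := by
        rw [hsCompressibility_eq hEq ⟨hη, hη₁₀⟩]; field_simp; ring
      rw [← hval']
      refine (hG η hη).hasDerivWithinAt.congr_of_eventuallyEq ?_ ?_
      · filter_upwards [self_mem_nhdsWithin] with x hx
        exact cm_cutF_of_ge hx
      · exact cm_cutF_of_ge le_rfl
    have := hleft.union hright
    rwa [Iic_union_Ici, hasDerivWithinAt_univ] at this
  · -- above the edge
    have hev : cutExcessFreeEnergy η₁ =ᶠ[𝓝 η] fun y => hsExcessFreeEnergy η₁ +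
        (hsCompressibility η₁ - 1) * Real.log (y / η₁) := by
      filter_upwards [Ioi_mem_nhds hgt] with x hx
      exact cm_cutF_of_ge (le_of_lt hx)
    have hd := (hG η hη).congr_of_eventuallyEq hev
    rwa [cm_cutZ_of_ge hgt.le]

end CutLaw

/-! ## The relative thermal energy of a monatomic law: temperature part + Bregman part -/

/-- **Explicit relative thermal energy of a monatomic law with excess free energy.**
`R(ρ,ϑ | r,Θ) = 3/2 ρ (ϑ − Θ − Θ log(ϑ/Θ)) + Θ [φ(ρ) − φ(r) − (log r + f(r) + χ(r))(ρ − r)]` with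
`φ(ρ) = ρ log ρ + ρ f(ρ)` (under the virial relation `φ' = log + f + χ`, so the bracket is the Bregman
divergence of the convex `φ`). Pure algebra (`r ≠ 0`). -/
theorem cm_relEnergyThermo_monatomic (χ f : ℝ → ℝ) {r : ℝ} (hr : r ≠ 0) (Θ ρ ϑ : ℝ) :
    (EulerEOS.monatomicExcess χ f).relEnergyThermo r Θ ρ ϑ =
      3 / 2 * ρ * (ϑ - Θ - Θ * (Real.log ϑ - Real.log Θ)) +
        Θ * ((ρ * Real.log ρ + ρ * f ρ) - (r * Real.log r + r * f r) -
          (Real.log r + f r + χ r) * (ρ - r)) := by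
  simp only [EulerEOS.relEnergyThermo, EulerEOS.ballisticFreeEnergy, EulerEOS.chemPotential,
    EulerEOS.monatomicExcess]
  field_simp
  ring

/-- The temperature part is non-negative: `ϑ − Θ − Θ log(ϑ/Θ) ≥ 0` (`log x ≤ x − 1`). -/
theorem cm_temp_part_nonneg {Θ ϑ : ℝ} (hΘ : 0 < Θ) (hϑ : 0 < ϑ) :
    0 ≤ ϑ - Θ - Θ * (Real.log ϑ - Real.log Θ) := by
  have h := Real.log_le_sub_one_of_pos (div_pos hϑ hΘ)
  rw [Real.log_div hϑ.ne' hΘ.ne', div_sub_one hΘ.ne', le_div_iff₀ hΘ] at h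
  nlinarith [h]

/-- **Bregman divergences of functions with monotone derivative are non-negative** on `(0,∞)`:
if `Φ' = Ψ` on `(0,∞)` and `Ψ` is monotone there, then `Φ(ρ) − Φ(r) − Ψ(r)(ρ − r) ≥ 0`. -/
theorem cm_bregman_nonneg {Φ Ψ : ℝ → ℝ} (hd : ∀ x, 0 < x → HasDerivAt Φ (Ψ x) x)
    (hm : MonotoneOn Ψ (Ioi 0)) {ρ r : ℝ} (hρ : 0 < ρ) (hr : 0 < r) :
    0 ≤ Φ ρ - Φ r - Ψ r * (ρ - r) := by
  set g : ℝ → ℝ := fun x => Φ x - Ψ r * x with hg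
  have hderiv : ∀ x, 0 < x → HasDerivAt g (Ψ x - Ψ r) x := fun x hx => by
    have := (hd x hx).fun_sub ((hasDerivAt_id' x).const_mul (Ψ r))
    simpa [hg] using this
  have key : g r ≤ g ρ := by
    rcases le_total r ρ with h | h
    · have hmono : MonotoneOn g (Ici r) := by
        refine monotoneOn_of_deriv_nonneg (convex_Ici r) (fun x hx => ?_) (fun x hx => ?_)
          (fun x hx => ?_)
        · exact (hderiv x (hr.trans_le hx)).continuousAt.continuousWithinAt
        · rw [interior_Ici] at hx
          exact (hderiv x (hr.trans hx)).differentiableAt.differentiableWithinAt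
        · rw [interior_Ici] at hx
          rw [(hderiv x (hr.trans hx)).deriv, sub_nonneg]
          exact hm hr (hr.trans hx) (le_of_lt hx)
      exact hmono (le_refl r) h h
    · have hanti : AntitoneOn g (Ioc 0 r) := by
        refine antitoneOn_of_deriv_nonpos (convex_Ioc 0 r) (fun x hx => ?_) (fun x hx => ?_)
          (fun x hx => ?_)
        · exact (hderiv x hx.1).continuousAt.continuousWithinAt
        · rw [interior_Ioc] at hx
          exact (hderiv x hx.1).differentiableAt.differentiableWithinAt
        · rw [interior_Ioc] at hx
          rw [(hderiv x hx.1).deriv, sub_nonpos]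
          exact hm hx.1 hr (le_of_lt hx.2)
      exact hanti ⟨hρ, h⟩ ⟨hr, le_refl r⟩ h
  have : Φ ρ - Φ r - Ψ r * (ρ - r) = g ρ - g r := by simp only [hg]; ring
  rw [this]; linarith

section Convexity

variable {η₀ η₁ : ℝ} {F : ℝ → ℝ}

/-- **Monotonicity of `φ'` for the cut law.** With `Ψ(x) = (1 − z)(log x + 1) + F_cut(xσ³) + Z_cut(xσ³) − 1`
(the derivative of `(1 − z) x log x + x F_cut(xσ³)`), `Ψ` is non-decreasing on `(0,∞)` as soon as
`z ≤ (ηZ)'(η) = 1 + 2ηF' + η²F''` on `(0, η₁)` and `z ≤ Z(η₁)`: on each side of the band edge `Ψ` is smooth with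
`x Ψ'(x) = (ηZ_cut)' − z ≥ 0`, and `Ψ` is continuous across. -/
theorem cm_psi_monotoneOn (hF : AnalyticOnNhd ℝ F (Ioo (-η₀) η₀))
    (hEq : EqOn hsExcessFreeEnergy F (Ico 0 η₀)) (hη₁ : 0 < η₁) (hη₁₀ : η₁ < η₀) {σ z : ℝ} (hσ : 0 < σ)
    (hW : ∀ η ∈ Ioo 0 η₁, z ≤ 1 + 2 * η * deriv F η + η ^ 2 * deriv (deriv F) η)
    (hZ1 : z ≤ 1 + η₁ * deriv F η₁) :
    MonotoneOn (fun x => (1 - z) * (Real.log x + 1) + cutExcessFreeEnergy η₁ (x * σ ^ 3) +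
      (cutCompressibility η₁ (x * σ ^ 3) - 1)) (Ioi 0) := by
  set Ψ : ℝ → ℝ := fun x => (1 - z) * (Real.log x + 1) + cutExcessFreeEnergy η₁ (x * σ ^ 3) +
      (cutCompressibility η₁ (x * σ ^ 3) - 1) with hΨ
  have hσ3 : 0 < σ ^ 3 := by positivity
  have hFd : ∀ x ∈ Ioo (-η₀) η₀, HasDerivAt F (deriv F x) x := fun x hx =>
    (hF x hx).differentiableAt.hasDerivAt
  have hF1d : ∀ x ∈ Ioo (-η₀) η₀, HasDerivAt (deriv F) (deriv (deriv F) x) x := fun x hx =>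
    (hF.deriv x hx).differentiableAt.hasDerivAt
  -- continuity on `(0,∞)`
  have hmaps : MapsTo (fun x : ℝ => x * σ ^ 3) (Ioi 0) (Ioi 0) := fun x hx => mul_pos hx hσ3
  have hΨc : ContinuousOn Ψ (Ioi 0) := by
    have h1 : ContinuousOn (fun x : ℝ => Real.log x) (Ioi 0) :=
      Real.continuousOn_log.mono fun x hx => ne_of_gt hx
    have h2 : ContinuousOn (fun x : ℝ => cutExcessFreeEnergy η₁ (x * σ ^ 3)) (Ioi 0) :=
      (cc_continuousOn_cutExcessFreeEnergy hF hEq hη₁ hη₁₀).comp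
        (continuousOn_id.mul continuousOn_const) hmaps
    have h3 : ContinuousOn (fun x : ℝ => cutCompressibility η₁ (x * σ ^ 3)) (Ioi 0) :=
      (cc_continuousOn_cutCompressibility hF hEq hη₁ hη₁₀).comp
        (continuousOn_id.mul continuousOn_const) hmaps
    exact ((continuousOn_const.mul (h1.add continuousOn_const)).add h2).add (h3.sub continuousOn_const)
  set ρ₁ : ℝ := η₁ / σ ^ 3 with hρ₁
  have hρ₁pos : 0 < ρ₁ := div_pos hη₁ hσ3
  have hρ₁mul : ρ₁ * σ ^ 3 = η₁ := by rw [hρ₁]; field_simp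
  -- piece below the edge
  have hlow : MonotoneOn Ψ (Ioc 0 ρ₁) := by
    have hc : ∀ x, 0 < x → x < ρ₁ → ∃ D, HasDerivAt Ψ D x ∧ 0 ≤ D := by
      intro x hx0 hx1
      have hxη : x * σ ^ 3 < η₁ := by rw [← hρ₁mul]; exact mul_lt_mul_of_pos_right hx1 hσ3
      have hxU : x * σ ^ 3 ∈ Ioo (-η₀) η₀ := ⟨by nlinarith [mul_pos hx0 hσ3], hxη.trans hη₁₀⟩
      have hev : Ψ =ᶠ[𝓝 x] fun y => (1 - z) * (Real.log y + 1) + F (y * σ ^ 3) +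
          y * σ ^ 3 * deriv F (y * σ ^ 3) := by
        filter_upwards [Ioo_mem_nhds hx0 hx1] with y hy
        have hy3 : 0 < y * σ ^ 3 := mul_pos hy.1 hσ3
        have hyη : y * σ ^ 3 < η₁ := by rw [← hρ₁mul]; exact mul_lt_mul_of_pos_right hy.2 hσ3
        simp only [hΨ, cm_cutF_eq_F hEq hη₁ hη₁₀ hy3.le hyη.le, cm_cutZ_of_le hyη.le,
          hsCompressibility_eq hEq ⟨hy3, hyη.trans hη₁₀⟩]
        ring
      have hA := ((Real.hasDerivAt_log hx0.ne').add_const 1).const_mul (1 - z)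
      have hB : HasDerivAt (fun y => F (y * σ ^ 3)) (deriv F (x * σ ^ 3) * σ ^ 3) x :=
        (hFd _ hxU).comp x (hasDerivAt_mul_const (σ ^ 3))
      have hB' : HasDerivAt (fun y => deriv F (y * σ ^ 3)) (deriv (deriv F) (x * σ ^ 3) * σ ^ 3) x := by
        have h := (hF1d (x * σ ^ 3) hxU).comp x (hasDerivAt_mul_const (σ ^ 3))
        exact h
      have hC : HasDerivAt (fun y => y * σ ^ 3 * deriv F (y * σ ^ 3))
          (σ ^ 3 * deriv F (x * σ ^ 3) + x * σ ^ 3 * (deriv (deriv F) (x * σ ^ 3) * σ ^ 3)) x :=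
        (hasDerivAt_mul_const (σ ^ 3)).fun_mul hB'
      have h := ((hA.fun_add hB).fun_add hC).congr_of_eventuallyEq hev
      refine ⟨_, h, ?_⟩
      have hWx := hW (x * σ ^ 3) ⟨mul_pos hx0 hσ3, hxη⟩
      have e : (1 - z) * x⁻¹ + deriv F (x * σ ^ 3) * σ ^ 3 +
          (σ ^ 3 * deriv F (x * σ ^ 3) + x * σ ^ 3 * (deriv (deriv F) (x * σ ^ 3) * σ ^ 3)) =
          (1 + 2 * (x * σ ^ 3) * deriv F (x * σ ^ 3) +
            (x * σ ^ 3) ^ 2 * deriv (deriv F) (x * σ ^ 3) - z) / x := by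
        field_simp
        ring
      rw [e]
      exact div_nonneg (by linarith) hx0.le
    refine monotoneOn_of_deriv_nonneg (convex_Ioc 0 ρ₁) (hΨc.mono fun x hx => hx.1) ?_ ?_
    · intro x hx
      rw [interior_Ioc] at hx
      obtain ⟨D, hD, -⟩ := hc x hx.1 hx.2
      exact hD.differentiableAt.differentiableWithinAt
    · intro x hx
      rw [interior_Ioc] at hx
      obtain ⟨D, hD, hD0⟩ := hc x hx.1 hx.2
      rw [hD.deriv]; exact hD0
  -- piece above the edge
  have hhigh : MonotoneOn Ψ (Ici ρ₁) := by
    have hc : ∀ x, ρ₁ < x → HasDerivAt Ψ ((hsCompressibility η₁ - z) / x) x := by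
      intro x hx
      have hx0 : 0 < x := hρ₁pos.trans hx
      have hxη : η₁ < x * σ ^ 3 := by rw [← hρ₁mul]; exact mul_lt_mul_of_pos_right hx hσ3
      have hev : Ψ =ᶠ[𝓝 x] fun y => (1 - z) * (Real.log y + 1) +
          (hsExcessFreeEnergy η₁ + (hsCompressibility η₁ - 1) * Real.log (y * σ ^ 3 / η₁)) +
            (hsCompressibility η₁ - 1) := by
        filter_upwards [Ioi_mem_nhds hx] with y hy
        have hyη : η₁ ≤ y * σ ^ 3 := by
          rw [← hρ₁mul]; exact (mul_lt_mul_of_pos_right hy hσ3).le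
        simp only [hΨ, cm_cutF_of_ge hyη, cm_cutZ_of_ge hyη]
      have hlog : HasDerivAt (fun y : ℝ => Real.log (y * σ ^ 3 / η₁)) x⁻¹ x := by
        have h := ((hasDerivAt_mul_const (σ ^ 3)).div_const η₁ (x := x)).log
          (by positivity : x * σ ^ 3 / η₁ ≠ 0)
        refine h.congr_deriv ?_
        field_simp
      have h := ((((Real.hasDerivAt_log hx0.ne').add_const 1).const_mul (1 - z)).fun_add
        ((hlog.const_mul (hsCompressibility η₁ - 1)).const_add (hsExcessFreeEnergy η₁))).add_const
          (hsCompressibility η₁ - 1)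
      refine (h.congr_of_eventuallyEq hev).congr_deriv ?_
      field_simp
      ring
    refine monotoneOn_of_deriv_nonneg (convex_Ici ρ₁) (hΨc.mono fun x hx => hρ₁pos.trans_le hx) ?_ ?_
    · intro x hx
      rw [interior_Ici] at hx
      exact (hc x hx).differentiableAt.differentiableWithinAt
    · intro x hx
      rw [interior_Ici] at hx
      rw [(hc x hx).deriv]
      refine div_nonneg ?_ (hρ₁pos.trans hx).le
      rw [hsCompressibility_eq hEq ⟨hη₁, hη₁₀⟩]
      linarith
  -- glue
  intro x hx y hy hxy
  rcases le_total y ρ₁ with hy₁ | hy₁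
  · exact hlow ⟨hx, hxy.trans hy₁⟩ ⟨hy, hy₁⟩ hxy
  · rcases le_total x ρ₁ with hx₁ | hx₁
    · exact (hlow ⟨hx, hx₁⟩ ⟨hρ₁pos, le_rfl⟩ hx₁).trans (hhigh Set.self_mem_Ici hy₁ hy₁)
    · exact hhigh hx₁ hy₁ hxy

/-- **The Bregman part of the cut law dominates `z` times that of the ideal gas**: with
`φ(ρ) = ρ log ρ + ρ F_cut(ρσ³)` and `φ'(r) = log r + F_cut(rσ³) + Z_cut(rσ³)`,
`φ(ρ) − φ(r) − φ'(r)(ρ − r) ≥ z (ρ log ρ − r log r − (log r + 1)(ρ − r))` for `ρ, r > 0`, provided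
`z ≤ (ηZ)'` on `(0,η₁)` and `z ≤ Z(η₁)` (`φ − z ρ log ρ` is then convex: `cm_psi_monotoneOn`). -/
theorem cm_bregman_cut_ge (hF : AnalyticOnNhd ℝ F (Ioo (-η₀) η₀))
    (hEq : EqOn hsExcessFreeEnergy F (Ico 0 η₀)) (hη₁ : 0 < η₁) (hη₁₀ : η₁ < η₀) {σ z : ℝ} (hσ : 0 < σ)
    (hW : ∀ η ∈ Ioo 0 η₁, z ≤ 1 + 2 * η * deriv F η + η ^ 2 * deriv (deriv F) η)
    (hZ1 : z ≤ 1 + η₁ * deriv F η₁) {ρ r : ℝ} (hρ : 0 < ρ) (hr : 0 < r) :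
    z * (ρ * Real.log ρ - r * Real.log r - (Real.log r + 1) * (ρ - r)) ≤
      (ρ * Real.log ρ + ρ * cutExcessFreeEnergy η₁ (ρ * σ ^ 3)) -
        (r * Real.log r + r * cutExcessFreeEnergy η₁ (r * σ ^ 3)) -
        (Real.log r + cutExcessFreeEnergy η₁ (r * σ ^ 3) + cutCompressibility η₁ (r * σ ^ 3)) *
          (ρ - r) := by
  have hσ3 : 0 < σ ^ 3 := by positivity
  -- `Φ = (1 - z) x log x + x F_cut(xσ³)` has derivative `Ψ`
  have hd : ∀ x, 0 < x → HasDerivAt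
      (fun x => (1 - z) * (x * Real.log x) + x * cutExcessFreeEnergy η₁ (x * σ ^ 3))
      ((1 - z) * (Real.log x + 1) + cutExcessFreeEnergy η₁ (x * σ ^ 3) +
        (cutCompressibility η₁ (x * σ ^ 3) - 1)) x := by
    intro x hx
    have hx3 : 0 < x * σ ^ 3 := mul_pos hx hσ3
    have h1 := (Real.hasDerivAt_mul_log hx.ne').const_mul (1 - z)
    have h2 : HasDerivAt (fun y => cutExcessFreeEnergy η₁ (y * σ ^ 3))
        ((cutCompressibility η₁ (x * σ ^ 3) - 1) / (x * σ ^ 3) * σ ^ 3) x := by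
      have h := (cm_hasDerivAt_cutF hF hEq hη₁ hη₁₀ hx3).comp x (hasDerivAt_mul_const (σ ^ 3))
      exact h
    have h3 := (hasDerivAt_id' x).fun_mul h2
    refine (h1.fun_add h3).congr_deriv ?_
    field_simp
    ring
  have h := cm_bregman_nonneg hd (cm_psi_monotoneOn hF hEq hη₁ hη₁₀ hσ hW hZ1) hρ hr
  nlinarith [h]

end Convexity

/-! ## Global coercivity of the cut law -/

/-- **Global coercivity of the cut law through the ideal gas.** For `z ≤ 1` with `z ≤ (ηZ)'` on `(0,η₁)`
and `z ≤ Z(η₁)`, the relative thermal energy of `cutEOS σ η₁` dominates `z` times that of the monatomic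
ideal gas: `R_cut(ρ,ϑ | r,Θ) ≥ z R_ideal(ρ,ϑ | r,Θ)` for all `r, Θ, ρ, ϑ > 0` (temperature parts coincide,
Bregman parts compare by `cm_bregman_cut_ge`). -/
theorem cm_relEnergyThermo_cut_ge {η₀ η₁ : ℝ} {F : ℝ → ℝ} (hF : AnalyticOnNhd ℝ F (Ioo (-η₀) η₀))
    (hEq : EqOn hsExcessFreeEnergy F (Ico 0 η₀)) (hη₁ : 0 < η₁) (hη₁₀ : η₁ < η₀) {σ z : ℝ} (hσ : 0 < σ)
    (hz1 : z ≤ 1) (hW : ∀ η ∈ Ioo 0 η₁, z ≤ 1 + 2 * η * deriv F η + η ^ 2 * deriv (deriv F) η)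
    (hZ1 : z ≤ 1 + η₁ * deriv F η₁) {r Θ ρ ϑ : ℝ} (hr : 0 < r) (hΘ : 0 < Θ) (hρ : 0 < ρ) (hϑ : 0 < ϑ) :
    z * (EulerEOS.monatomicExcess (fun _ => 1) (fun _ => 0)).relEnergyThermo r Θ ρ ϑ ≤
      (cutEOS σ η₁).relEnergyThermo r Θ ρ ϑ := by
  have hT := cm_temp_part_nonneg hΘ hϑ
  have hB := cm_bregman_cut_ge hF hEq hη₁ hη₁₀ hσ hW hZ1 hρ hr
  have e1 : (EulerEOS.monatomicExcess (fun _ => 1) (fun _ => 0)).relEnergyThermo r Θ ρ ϑ =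
      3 / 2 * ρ * (ϑ - Θ - Θ * (Real.log ϑ - Real.log Θ)) +
        Θ * (ρ * Real.log ρ - r * Real.log r - (Real.log r + 1) * (ρ - r)) := by
    rw [cm_relEnergyThermo_monatomic _ _ hr.ne']; ring
  have e2 : (cutEOS σ η₁).relEnergyThermo r Θ ρ ϑ =
      3 / 2 * ρ * (ϑ - Θ - Θ * (Real.log ϑ - Real.log Θ)) +
        Θ * ((ρ * Real.log ρ + ρ * cutExcessFreeEnergy η₁ (ρ * σ ^ 3)) -
          (r * Real.log r + r * cutExcessFreeEnergy η₁ (r * σ ^ 3)) -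
          (Real.log r + cutExcessFreeEnergy η₁ (r * σ ^ 3) + cutCompressibility η₁ (r * σ ^ 3)) *
            (ρ - r)) := by
    unfold cutEOS; rw [cm_relEnergyThermo_monatomic _ _ hr.ne']
  rw [e1, e2]
  have h1 := mul_le_mul_of_nonneg_left hB hΘ.le
  have h2 : 0 ≤ (1 - z) * (3 / 2 * ρ * (ϑ - Θ - Θ * (Real.log ϑ - Real.log Θ))) :=
    mul_nonneg (by linarith) (by positivity)
  nlinarith [h1, h2]


end Summit.AtomisticToContinuum.HydrodynamicLimit.Theorems.RES

end
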